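import Summits.FinalStateConjecture.FinalStateConjecture.Theorems.KerrCaptureOnRays.Negative.KerrCaptureOnRaysRelabelling

/-!
# `KerrCaptureOnRays` (stmt-FinalStateConjecture-17669, route `TangentConeAtIPlus`) is false as soon as its own
# hypothesis is satisfiable with one hole — negative lemma modulo `NonDispersiveConeData` (refuter crux-attack seat)

`KerrCaptureOnRays` (K2) says: for EVERY admissible datum, EVERY MGHD and EVERY cone data
`(N, (Λᵢ,cᵢ), σᵢ, drᵢ, T, U, Φ)` there are hole data `(Mᵢ, aᵢ, τ₀, Ψᵢ)`; among the hole clauses is the GLUING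
clause: at every late rest time `tᵢ x > τ₀`, on the annulus `σᵢ(tᵢ x) + 1 ≤ dᵢ x < σᵢ(tᵢ x) + 4`, `Ψᵢ x = Φ (x + drᵢ (tᵢ x))`,
with `Ψᵢ` an open embedding (hence injective) on the near region `Wᵢ ⊇` these annuli.

**The defect (missing normalisation).** The drift `drᵢ : ℝ → E4` is only asked to be continuous and sublinear; nothing
makes it SPATIAL in the rest frame of `(Λᵢ, cᵢ)`, so the shift `x ↦ x + drᵢ (tᵢ x)` need neither preserve rest time nor be
injective.  Consequently cone data can be RELABELLED: for a continuous `g s = s + f s` (`0 ≤ f ≤ 2`, so `g` is onto) put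
`σᵢ' := σᵢ ∘ g`, `drᵢ' s := drᵢ (g s) + f s • Λᵢ e₀`.  Then `x + drᵢ'(tᵢ x) = shift (Γ x)` with `Γ x = x + f (tᵢ x) • Λᵢ e₀`
(`tᵢ ∘ Γ = g ∘ tᵢ`, `dᵢ ∘ Γ = dᵢ`, `Γ` onto), so the drifted TUBES ARE LITERALLY THE SAME SETS, `U`, `Φ`, `T`, the
orthochronous motions, the weighted/wave-zone clauses are untouched, continuity/sublinearity survive, and every recurrent
basin window at a time `τ` with `f ≡ 0` on `[τ-1, τ+1]` survives verbatim (`exists_cone_without_holes`, part (A)).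
Choosing `f` = periodic piecewise-linear blips (`blip θ`, period `100`, support `(θ+100k+10, θ+100k+12)`, descending
slope `-2`), with the phase `θ ∈ {0, 50}` picked per hole by an abstract dichotomy (`recurrent_dichotomy`,
`blip_clean_or`: every window of half-width `1` is clean for one of the two phases, and recurrence is monotone in `ε`),
`g` FOLDS in every period: `g (θ+100k+43/4) = g (θ+100k+47/4)`.  Hence two distinct late annulus points (rest times
`s₁ ≠ s₂`, common radius `σ(v)+2`, `v` the common value) are glued to the SAME point `y`, and the gluing clause gives
`Ψᵢ x₁ = Φ y = Ψᵢ x₂`, contradicting injectivity (part (B); the bookkeeping that `x_j ∈ Wᵢ`, `x_j` lies in the boosted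
Kerr exterior for whatever `(Mᵢ, aᵢ)` the hole data chose, and that `y` has flat time `> T + 1`, uses `σᵢ → ∞`,
sublinearity and orthochronicity of `Λᵢ`).

**What is landed.** `KerrCaptureOnRays_false_of_NonDispersiveConeData : NonDispersiveConeData → ¬ KerrCaptureOnRays`,
where `NonDispersiveConeData` = "some admissible MGHD carries cone data with `0 < N`" = K2's own hypothesis, satisfied
non-vacuously.  So K2 AS TYPED is equivalent to "no admissible MGHD carries cone data with a hole" (for `N = 0` its
conclusion is trivially true): vacuous-or-false, never the localised Kerr-stability statement it was meant to be.
`H` is not constructible in the tree (it needs an MGHD containing a black hole; MGHD existence itself is the named fact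
`choquetBruhat_geroch_exists_mghd_cauchy`, and on the one inhabited development, Minkowski's, the basin clause forces
`N = 0`), hence the `--negative-modulo` lane and no verdict change.

**Classification: misstated; repair.** Minimal repair `C′`: add to the per-hole conjunct of the shared `Cone` predicate
`∀ s, ((mo i).1 : E4 ≃L[ℝ] E4).symm (dr i s) 0 = 0` (drift spatial in the rest frame ⇒ the shift preserves rest time and
is a bijection of `E4`); this witness then dies (`f ≠ 0` is exactly a rest-frame time component).  Recommended: let the
`Holes` predicate quantify its OWN continuous sublinear spatial `(σ̂ᵢ, d̂rᵢ)` rather than inherit the cone's `σᵢ, drᵢ` at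
non-window times, about which `Cone` certifies nothing.  `Cone` is shared verbatim by `FiniteKerrParticleCone`,
`ConeCompletesScri`, `DecoratedConeExhausts`: all four items must be restated together.
-/

set_option linter.dupNamespace false

noncomputable section

namespace Summit.FinalStateConjecture.FinalStateConjecture.Theorems.KerrCaptureOnRays.Negative

open scoped BigOperators Topology Manifold Classical MeasureTheory ProbabilityTheory Matrix InnerProductSpace ComplexConjugate ContinuousMap
open Filter Set Function TopologicalSpace MeasureTheory
open Literature.Geometry.Lorentzian
open scoped ContDiff ENNReal

/-! ## The relabelling kills the gluing clause -/

/-- **Main lemma (pure bookkeeping, any spacetime).** Cone data with at least one hole can be RELABELLED —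
same spacetime, motions, `T`, `U`, `Φ`, same tubes — into cone data to which NO hole data can be glued. -/
theorem exists_cone_without_holes (𝓢 : Spacetime.{0} 4) (S : Set 𝓢.carrier) (N : ℕ)
    (mo : Fin N → lorentzGroup × E4) (σ : Fin N → ℝ → ℝ) (dr : Fin N → ℝ → E4) (T : ℝ)
    (U : Opens E4) (Φ : U → 𝓢.carrier) (hN : 0 < N) (h : Cone 𝓢 S N mo σ dr T U Φ) :
    ∃ (σ' : Fin N → ℝ → ℝ) (dr' : Fin N → ℝ → E4), Cone 𝓢 S N mo σ' dr' T U Φ ∧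
      ∀ (M a : Fin N → ℝ) (τ₀ : ℝ)
        (Ψ : ∀ i, (boostedKerrBackground (mo i).1 (mo i).2 (M i) (a i)).domain → 𝓢.carrier),
        ¬ Holes 𝓢 S N mo σ' dr' T U Φ M a τ₀ Ψ := by
  simp only [Cone] at h
  obtain ⟨h1, h2, h3, h4, h5, h6, h7, h8⟩ := h
  have h8' : ∀ i, ∃ M a : ℝ, Kerr.IsSubextremal M a ∧ ∀ ε : ℝ≥0∞, 0 < ε → ∀ τ₁ : ℝ, ∃ τ : ℝ,
      τ₁ ≤ τ ∧ Window 𝓢 N mo σ dr U Φ i M a ε τ := h8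
  clear h8
  -- Step 1: for every hole, a phase whose blips avoid a cofinal family of recurrent windows
  have key : ∀ i, ∃ θ : ℝ, 0 ≤ θ ∧ ∃ M a : ℝ, Kerr.IsSubextremal M a ∧ ∀ ε : ℝ≥0∞, 0 < ε →
      ∀ τ₁ : ℝ, ∃ τ : ℝ, τ₁ ≤ τ ∧ (∀ s, |s - τ| ≤ 1 → blip θ s = 0) ∧
        Window 𝓢 N mo σ dr U Φ i M a ε τ := by
    intro i
    obtain ⟨M, a, hMa, hrec⟩ := h8' i
    have hmono : ∀ (ε ε' : ℝ≥0∞) (τ : ℝ), ε ≤ ε' → Window 𝓢 N mo σ dr U Φ i M a ε τ →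
        Window 𝓢 N mo σ dr U Φ i M a ε' τ := by
      intro ε ε' τ hle hW
      simp only [Window] at hW ⊢
      obtain ⟨Ψ, hΨ1, hΨ2, hΨ3, hΨ4⟩ := hW
      exact ⟨Ψ, hΨ1, hΨ2, hΨ3, hΨ4.trans hle⟩
    rcases recurrent_dichotomy (P := fun ε τ => Window 𝓢 N mo σ dr U Φ i M a ε τ)
        (C₀ := fun τ => ∀ s, |s - τ| ≤ 1 → blip 0 s = 0)
        (C₁ := fun τ => ∀ s, |s - τ| ≤ 1 → blip 50 s = 0) hmono hrec blip_clean_or with H | H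
    · exact ⟨0, le_rfl, M, a, hMa, H⟩
    · exact ⟨50, by norm_num, M, a, hMa, H⟩
  choose θ hθ M₀ a₀ hMa hrec using key
  -- the rest-frame time axes and the relabelled radii / drifts
  obtain ⟨e, he⟩ : ∃ e : Fin N → E4, ∀ i, e i = ((mo i).1 : E4 ≃L[ℝ] E4) (E4.basisVector 0) :=
    ⟨_, fun _ => rfl⟩
  obtain ⟨σ', hσ'⟩ : ∃ σ' : Fin N → ℝ → ℝ, ∀ i s, σ' i s = σ i (s + blip (θ i) s) :=
    ⟨_, fun _ _ => rfl⟩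
  obtain ⟨dr', hdr'⟩ : ∃ dr' : Fin N → ℝ → E4,
      ∀ i s, dr' i s = dr i (s + blip (θ i) s) + blip (θ i) s • e i := ⟨_, fun _ _ => rfl⟩
  -- rest-frame bookkeeping (local copies; named versions exist elsewhere in the tree)
  have hsp0 : E4.spatial (E4.basisVector 0) = 0 := by
    ext j
    simp [E4.spatial_apply, Fin.succ_ne_zero]
  have hpadd : ∀ (Λ : lorentzGroup) (c x : E4) (r : ℝ),
      poincareInv Λ c (x + r • (Λ : E4 ≃L[ℝ] E4) (E4.basisVector 0)) =
        poincareInv Λ c x + r • E4.basisVector 0 := by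
    intro Λ c x r
    simp only [poincareInv]
    rw [show x + r • (Λ : E4 ≃L[ℝ] E4) (E4.basisVector 0) - c =
        (x - c) + r • (Λ : E4 ≃L[ℝ] E4) (E4.basisVector 0) by abel]
    rw [map_add, map_smul, ContinuousLinearEquiv.symm_apply_apply]
  have hots : ∀ (s r : ℝ) (w : E3),
      E4.ofTimeSpace s w + r • E4.basisVector 0 = E4.ofTimeSpace (s + r) w := by
    intro s r w
    ext i
    refine Fin.cases ?_ (fun j => ?_) i
    · simp
    · simp [Fin.succ_ne_zero]
  have hΓt : ∀ i (x : E4) (r : ℝ), poincareInv (mo i).1 (mo i).2 (x + r • e i) 0 =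
      poincareInv (mo i).1 (mo i).2 x 0 + r := by
    intro i x r
    rw [he, hpadd]
    simp
  have hΓd : ∀ i (x : E4) (r : ℝ), E4.spatialNorm (poincareInv (mo i).1 (mo i).2 (x + r • e i)) =
      E4.spatialNorm (poincareInv (mo i).1 (mo i).2 x) := by
    intro i x r
    rw [he, hpadd]
    simp [E4.spatialNorm, map_add, map_smul, hsp0]
  -- the drifted tubes are unchanged
  have tube_eq : ∀ i (w : ℝ),
      (fun x : E4 => x + dr' i (poincareInv (mo i).1 (mo i).2 x 0)) ''
          {x : E4 | E4.spatialNorm (poincareInv (mo i).1 (mo i).2 x) ≤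
            σ' i (poincareInv (mo i).1 (mo i).2 x 0) + w} =
        (fun x : E4 => x + dr i (poincareInv (mo i).1 (mo i).2 x 0)) ''
          {x : E4 | E4.spatialNorm (poincareInv (mo i).1 (mo i).2 x) ≤
            σ i (poincareInv (mo i).1 (mo i).2 x 0) + w} := by
    intro i w
    set Γ : E4 → E4 := fun x => x + blip (θ i) (poincareInv (mo i).1 (mo i).2 x 0) • e i with hΓ
    have hΓsurj : Function.Surjective Γ := by
      intro y
      obtain ⟨s, hs⟩ := add_blip_surjective (θ i) (poincareInv (mo i).1 (mo i).2 y 0)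
      simp only at hs
      refine ⟨y + (-blip (θ i) s) • e i, ?_⟩
      have ht : poincareInv (mo i).1 (mo i).2 (y + (-blip (θ i) s) • e i) 0 = s := by
        rw [hΓt]; linarith
      simp only [hΓ, ht]
      rw [add_assoc, ← add_smul, neg_add_cancel, zero_smul, add_zero]
    have hcomp : (fun x : E4 => x + dr' i (poincareInv (mo i).1 (mo i).2 x 0)) =
        (fun y : E4 => y + dr i (poincareInv (mo i).1 (mo i).2 y 0)) ∘ Γ := by
      funext x
      simp only [Function.comp_apply, hΓ, hdr', hΓt]
      abel
    have hpre : {x : E4 | E4.spatialNorm (poincareInv (mo i).1 (mo i).2 x) ≤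
          σ' i (poincareInv (mo i).1 (mo i).2 x 0) + w} =
        Γ ⁻¹' {x : E4 | E4.spatialNorm (poincareInv (mo i).1 (mo i).2 x) ≤
          σ i (poincareInv (mo i).1 (mo i).2 x 0) + w} := by
      ext x
      simp only [mem_setOf_eq, mem_preimage, hΓ, hσ', hΓt, hΓd]
    rw [hcomp, hpre, Set.image_comp, Set.image_preimage_eq _ hΓsurj]
  refine ⟨σ', dr', ?_, ?_⟩
  · -- (A) the relabelled data are cone data
    simp only [Cone]
    refine ⟨?_, ?_, ?_, h4, h5, h6, h7, ?_⟩
    · intro i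
      obtain ⟨ho, hσc, hdrc, hsub, hσt⟩ := h1 i
      have hσ'f : σ' i = fun s => σ i (s + blip (θ i) s) := funext (hσ' i)
      have hdr'f : dr' i = fun s => dr i (s + blip (θ i) s) + blip (θ i) s • e i := funext (hdr' i)
      refine ⟨ho, ?_, ?_, ?_, ?_⟩
      · rw [hσ'f]; exact hσc.comp (continuous_id.add (continuous_blip _))
      · rw [hdr'f]
        exact (hdrc.comp (continuous_id.add (continuous_blip _))).add
          ((continuous_blip _).smul continuous_const)
      · rw [hσ'f, hdr'f]; exact tendsto_sublinear_relabel (θ i) (e i) hsub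
      · rw [hσ'f]; exact hσt.comp (tendsto_add_blip_atTop _)
    · intro i j hij
      rw [tube_eq i 5, tube_eq j 5]
      exact h2 i j hij
    · simp only [tube_eq]
      exact h3
    · intro i
      refine ⟨M₀ i, a₀ i, hMa i, fun ε hε τ₁ => ?_⟩
      obtain ⟨τ, hτ, hclean, hW⟩ := hrec i ε hε τ₁
      refine ⟨τ, hτ, ?_⟩
      have hσw : ∀ s, |s - τ| < 1 → σ' i s = σ i s := fun s hs => by
        rw [hσ', hclean s hs.le, add_zero]
      have hdrw : ∀ s, |s - τ| < 1 → dr' i s = dr i s := fun s hs => by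
        rw [hdr', hclean s hs.le, add_zero, zero_smul, add_zero]
      have hστ : σ' i τ = σ i τ := hσw τ (by simp)
      simp only [Window] at hW
      obtain ⟨Ψ, hΨs, hΨe, hΨa, hΨd⟩ := hW
      refine ⟨Ψ, hΨs, ?_, ?_, ?_⟩
      · have hWW : {x : (boostedKerrBackground (mo i).1 (mo i).2 (M₀ i) (a₀ i)).domain |
            |poincareInv (mo i).1 (mo i).2 x.1 0 - τ| < 1 ∧
              E4.spatialNorm (poincareInv (mo i).1 (mo i).2 x.1) <
                σ' i (poincareInv (mo i).1 (mo i).2 x.1 0) + |a₀ i| + 6} =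
            {x : (boostedKerrBackground (mo i).1 (mo i).2 (M₀ i) (a₀ i)).domain |
              |poincareInv (mo i).1 (mo i).2 x.1 0 - τ| < 1 ∧
              E4.spatialNorm (poincareInv (mo i).1 (mo i).2 x.1) <
                σ i (poincareInv (mo i).1 (mo i).2 x.1 0) + |a₀ i| + 6} := by
          ext x
          simp only [mem_setOf_eq]
          constructor
          · rintro ⟨hx1, hx2⟩
            exact ⟨hx1, by rwa [hσw _ hx1] at hx2⟩
          · rintro ⟨hx1, hx2⟩
            exact ⟨hx1, by rwa [hσw _ hx1]⟩
        rw [hWW]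
        exact hΨe
      · intro x hx1 hx2 hx3
        rw [hσw _ hx1] at hx2 hx3
        obtain ⟨hxU, hxe⟩ := hΨa x hx1 hx2 hx3
        have hdx : x.1 + dr' i (poincareInv (mo i).1 (mo i).2 x.1 0) =
            x.1 + dr i (poincareInv (mo i).1 (mo i).2 x.1 0) := by rw [hdrw _ hx1]
        refine ⟨hdx ▸ hxU, ?_⟩
        rw [hxe]
        congr 1
        exact Subtype.ext hdx.symm
      · rw [hστ]
        exact hΨd
  · -- (B) no hole data can be glued to the relabelled cone data
    intro M a τ₀ Ψ hH
    simp only [Holes] at hH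
    obtain ⟨hsub, -, hemb, -, -, hann, -⟩ := hH
    set i₀ : Fin N := ⟨0, hN⟩ with hi₀
    have hinj := (hemb i₀).2.1.injective
    have hann₀ := hann i₀
    clear hemb hann
    have hκ : 0 < e i₀ 0 := by rw [he]; exact (h1 i₀).1
    have hσt := (h1 i₀).2.2.2.2
    have hsl := (h1 i₀).2.2.2.1
    have hMpos : 0 < M i₀ := (hsub i₀).pos
    have hrp0 : 0 ≤ Kerr.rPlus (M i₀) (a i₀) := by
      unfold Kerr.rPlus; positivity
    -- thresholds for the late fold
    obtain ⟨u, hu⟩ : ∃ u : E4,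
        u = ((mo i₀).1 : E4 ≃L[ℝ] E4) (E4.ofTimeSpace 0 (EuclideanSpace.single 0 1)) := ⟨_, rfl⟩
    obtain ⟨S₁, hS₁⟩ := tendsto_atTop_atTop.mp hσt (Kerr.rPlus (M i₀) (a i₀) + |a i₀|)
    have hη : 0 < e i₀ 0 / (2 * (|u 0| + 1)) := by positivity
    obtain ⟨S₂, hS₂⟩ := (hsl.eventually (eventually_le_nhds hη)).exists_forall_of_atTop
    obtain ⟨Bd, hBd⟩ : ∃ Bd : ℝ, Bd = 2 * (|T + 1 - (mo i₀).2 0| + 2 * |u 0|) / e i₀ 0 := ⟨_, rfl⟩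
    have hBd0 : 0 ≤ Bd := by rw [hBd]; positivity
    obtain ⟨k, hk⟩ := exists_nat_ge ((|S₁| + |S₂| + |τ₀| + Bd + 3) / 100)
    have hkV : |S₁| + |S₂| + |τ₀| + Bd + 3 ≤ 100 * (k : ℝ) := by
      rw [div_le_iff₀ (by norm_num : (0 : ℝ) < 100)] at hk
      linarith only [hk]
    obtain ⟨v, hv⟩ : ∃ v : ℝ, v = θ i₀ + 100 * k + 49 / 4 := ⟨_, rfl⟩
    have hθ₀ := hθ i₀
    have hvS₁ : S₁ ≤ v := by
      linarith only [hv, hθ₀, hkV, le_abs_self S₁, abs_nonneg S₂, abs_nonneg τ₀, hBd0]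
    have hvS₂ : S₂ ≤ v := by
      linarith only [hv, hθ₀, hkV, le_abs_self S₂, abs_nonneg S₁, abs_nonneg τ₀, hBd0]
    have hvτ : τ₀ + 2 ≤ v := by
      linarith only [hv, hθ₀, hkV, le_abs_self τ₀, abs_nonneg S₁, abs_nonneg S₂, hBd0]
    have hvB : Bd + 1 ≤ v := by
      linarith only [hv, hθ₀, hkV, abs_nonneg τ₀, abs_nonneg S₁, abs_nonneg S₂]
    have hv1 : 1 ≤ v := by linarith only [hvB, hBd0]
    -- the common radius of the two fold points
    obtain ⟨ρ, hρ⟩ : ∃ ρ : ℝ, ρ = σ i₀ v + 2 := ⟨_, rfl⟩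
    have hσv : Kerr.rPlus (M i₀) (a i₀) + |a i₀| ≤ σ i₀ v := hS₁ v hvS₁
    have hρge : Kerr.rPlus (M i₀) (a i₀) + |a i₀| + 2 ≤ ρ := by linarith only [hσv, hρ]
    have hρa : |a i₀| ≤ ρ := by linarith only [hρge, hrp0]
    have hρ0 : 0 ≤ ρ := (abs_nonneg _).trans hρa
    obtain ⟨yv, hyv_def⟩ : ∃ yv : E3, yv = EuclideanSpace.single 0 ρ := ⟨_, rfl⟩
    have hyv : ‖yv‖ = ρ := by rw [hyv_def]; simp [abs_of_nonneg hρ0]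
    have hyv2 : yv 2 = 0 := by rw [hyv_def]; simp
    -- the glued point and its flat time
    obtain ⟨y, hy_def⟩ : ∃ y : E4,
        y = (mo i₀).2 + ((mo i₀).1 : E4 ≃L[ℝ] E4) (E4.ofTimeSpace v yv) + dr i₀ v := ⟨_, rfl⟩
    have hy0 : T + 1 < y 0 := by
      have hΛv : ((mo i₀).1 : E4 ≃L[ℝ] E4) (E4.ofTimeSpace v yv) = v • e i₀ + ρ • u := by
        rw [show E4.ofTimeSpace v yv = v • E4.basisVector 0 + E4.ofTimeSpace 0 yv by
          rw [add_comm, hots, zero_add], map_add, map_smul, he, hyv_def, ofTimeSpace_zero_single, map_smul, hu]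
      have h0 : y 0 = (mo i₀).2 0 + v * e i₀ 0 + (σ i₀ v + 2) * u 0 + dr i₀ v 0 := by
        rw [hy_def, hΛv, hρ]
        simp only [PiLp.add_apply, PiLp.smul_apply, smul_eq_mul]
        ring
      rw [h0]
      have hsl' := hS₂ v hvS₂
      rw [div_le_iff₀ (by linarith only [hv1])] at hsl'
      exact flat_time_gt hκ hv1 hsl' (by simpa using PiLp.norm_apply_le (dr i₀ v) 0)
        (by linarith only [hvB, hBd])
    -- the two fold witnesses glue to the same point
    have main : ∀ s : ℝ, τ₀ < s → s + blip (θ i₀) s = v →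
        ∃ (hm : (mo i₀).2 + ((mo i₀).1 : E4 ≃L[ℝ] E4) (E4.ofTimeSpace s yv) ∈
              (boostedKerrBackground (mo i₀).1 (mo i₀).2 (M i₀) (a i₀)).domain)
          (_ : (⟨_, hm⟩ : (boostedKerrBackground (mo i₀).1 (mo i₀).2 (M i₀) (a i₀)).domain) ∈
              {x : (boostedKerrBackground (mo i₀).1 (mo i₀).2 (M i₀) (a i₀)).domain |
                τ₀ < poincareInv (mo i₀).1 (mo i₀).2 x.1 0 ∧
                  E4.spatialNorm (poincareInv (mo i₀).1 (mo i₀).2 x.1) <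
                    σ' i₀ (poincareInv (mo i₀).1 (mo i₀).2 x.1 0) + |a i₀| + 6})
          (hyU : y ∈ (U : Set E4)), Ψ i₀ ⟨_, hm⟩ = Φ ⟨y, hyU⟩ := by
      intro s hτs hgs
      have hbs : blip (θ i₀) s = v - s := by linarith only [hgs]
      set ξ : E4 := E4.ofTimeSpace s yv with hξ
      set x : E4 := (mo i₀).2 + ((mo i₀).1 : E4 ≃L[ℝ] E4) ξ with hx
      have hpi : poincareInv (mo i₀).1 (mo i₀).2 x = ξ := poincareInv_add_apply _ _ _
      have ht : poincareInv (mo i₀).1 (mo i₀).2 x 0 = s := by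
        rw [hpi, hξ, E4.ofTimeSpace_apply_zero]
      have hsn : E4.spatialNorm ξ = ρ := by rw [hξ, E4.spatialNorm_ofTimeSpace, hyv]
      have hd : E4.spatialNorm (poincareInv (mo i₀).1 (mo i₀).2 x) = ρ := by rw [hpi, hsn]
      have hξ3 : ξ 3 = 0 := by
        rw [hξ, show (3 : Fin 4) = Fin.succ 2 from rfl, E4.ofTimeSpace_apply_succ]
        exact hyv2
      have hrad : Kerr.rPlus (M i₀) (a i₀) < Kerr.radius (a i₀) ξ := by
        have hsq := radius_sq_of_equatorial hξ3 (hsn ▸ hρa)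
        rw [hsn] at hsq
        refine lt_of_pow_lt_pow_left₀ 2 (Kerr.radius_nonneg _ _) ?_
        rw [hsq]
        exact sq_lt_sq_sub hrp0 hρge
      have hmem : x ∈ (boostedKerrBackground (mo i₀).1 (mo i₀).2 (M i₀) (a i₀)).domain := by
        show x ∈ boostedKerrExterior (mo i₀).1 (mo i₀).2 (M i₀) (a i₀)
        rw [mem_boostedKerrExterior, Kerr.mem_exterior, hpi]
        exact max_lt hrad (hrp0.trans_lt hrad)
      have hσ's : σ' i₀ s = σ i₀ v := by rw [hσ', hgs]
      have hdr's : dr' i₀ s = dr i₀ v + (v - s) • e i₀ := by rw [hdr', hgs, hbs]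
      have hxy : x + dr' i₀ (poincareInv (mo i₀).1 (mo i₀).2 x 0) = y := by
        rw [ht, hdr's, hy_def, hx, he]
        have h2 : ((mo i₀).1 : E4 ≃L[ℝ] E4) ξ + (v - s) • ((mo i₀).1 : E4 ≃L[ℝ] E4) (E4.basisVector 0) =
            ((mo i₀).1 : E4 ≃L[ℝ] E4) (E4.ofTimeSpace v yv) := by
          rw [← map_smul, ← map_add, hξ, hots, add_sub_cancel]
        rw [← h2]
        abel
      obtain ⟨hU, hEq⟩ := hann₀ ⟨x, hmem⟩ (show τ₀ < poincareInv (mo i₀).1 (mo i₀).2 x 0 by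
          rw [ht]; exact hτs)
        (show σ' i₀ (poincareInv (mo i₀).1 (mo i₀).2 x 0) + 1 ≤
            E4.spatialNorm (poincareInv (mo i₀).1 (mo i₀).2 x) by
          rw [ht, hd, hσ's]; linarith only [hρ])
        (show E4.spatialNorm (poincareInv (mo i₀).1 (mo i₀).2 x) <
            σ' i₀ (poincareInv (mo i₀).1 (mo i₀).2 x 0) + 4 by
          rw [ht, hd, hσ's]; linarith only [hρ])
        (show T + 1 < (x + dr' i₀ (poincareInv (mo i₀).1 (mo i₀).2 x 0)) 0 by rw [hxy]; exact hy0)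
      refine ⟨hmem, ?_, hxy ▸ hU, ?_⟩
      · show τ₀ < poincareInv (mo i₀).1 (mo i₀).2 x 0 ∧
          E4.spatialNorm (poincareInv (mo i₀).1 (mo i₀).2 x) <
            σ' i₀ (poincareInv (mo i₀).1 (mo i₀).2 x 0) + |a i₀| + 6
        rw [ht, hd, hσ's]
        exact ⟨hτs, by linarith only [hρ, abs_nonneg (a i₀)]⟩
      · rw [hEq]
        congr 1
        exact Subtype.ext hxy
    have hg₁ : (θ i₀ + 100 * k + 43 / 4) + blip (θ i₀) (θ i₀ + 100 * k + 43 / 4) = v := by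
      rw [blip_wit₁]; linarith only [hv]
    have hg₂ : (θ i₀ + 100 * k + 47 / 4) + blip (θ i₀) (θ i₀ + 100 * k + 47 / 4) = v := by
      rw [blip_wit₂]; linarith only [hv]
    obtain ⟨hm₁, hw₁, hyU₁, he₁⟩ := main _ (by linarith only [hvτ, hv]) hg₁
    obtain ⟨hm₂, hw₂, hyU₂, he₂⟩ := main _ (by linarith only [hvτ, hv]) hg₂
    have heq : Ψ i₀ ⟨_, hm₁⟩ = Ψ i₀ ⟨_, hm₂⟩ := by rw [he₁, he₂]
    have h12 := hinj (a₁ := ⟨⟨_, hm₁⟩, hw₁⟩) (a₂ := ⟨⟨_, hm₂⟩, hw₂⟩) heq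
    have hx12 : (mo i₀).2 + ((mo i₀).1 : E4 ≃L[ℝ] E4) (E4.ofTimeSpace (θ i₀ + 100 * k + 43 / 4) yv) =
        (mo i₀).2 + ((mo i₀).1 : E4 ≃L[ℝ] E4) (E4.ofTimeSpace (θ i₀ + 100 * k + 47 / 4) yv) :=
      congrArg (fun z => (z.1.1 : E4)) h12
    have hξ12 := ((mo i₀).1 : E4 ≃L[ℝ] E4).injective (add_left_cancel hx12)
    have := congrArg (fun w : E4 => w 0) hξ12
    simp only [E4.ofTimeSpace_apply_zero] at this
    linarith only [this]

/-! ## The negative lemma -/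

/-- **Negative lemma modulo `NonDispersiveConeData`: `KerrCaptureOnRays` is false as soon as its own hypothesis is
satisfiable with one hole.**  Equivalently, `KerrCaptureOnRays` as typed IMPLIES that no admissible MGHD carries
cone data with `N ≥ 1` — the item is (vacuously-or-)false, never informative. -/
theorem KerrCaptureOnRays_false_of_NonDispersiveConeData (hH : NonDispersiveConeData) :
    ¬ Summit.FinalStateConjecture.FinalStateConjecture.Theses.TangentConeAtIPlus.KerrCaptureOnRays := by
  intro hK
  obtain ⟨X, _, _, _, _, _, _, D, hD, 𝒟, h𝒟, N, mo, σ, dr, T, U, Φ, hN, hcone⟩ := hH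
  obtain ⟨σ', dr', hcone', hno⟩ := exists_cone_without_holes _ _ N mo σ dr T U Φ hN hcone
  obtain ⟨M, a, τ₀, Ψ, hholes⟩ := hK X D hD 𝒟 h𝒟 N mo σ' dr' T U Φ hcone'
  exact hno M a τ₀ Ψ hholes

end Summit.FinalStateConjecture.FinalStateConjecture.Theorems.KerrCaptureOnRays.Negative

end
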